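import Summits.QuantumFields.BalabanUV.T4Continuum.Support.NE7K1LinBoxRGStep

/-!
# NE7K1LinBoxThm110Step — row NE7 (node U5), candidate route HOM, path H1L, cell K1-lin(s): card §3y STEP 7, PART 4 —
# THE FLUCTUATION TERM OF ONE RENORMALIZATION STEP OF THE LINE IN THE WEIGHTED ROW NORM:
# `‖𝒢_{j+1}(s) − 𝒢_j(s)‖_{row,δ₀} ≤ Θe^{δ₀}·L^{−2(k−j)}`, SUMMABLE IN `j`, UNIFORMLY IN `s ∈ [0,1]`

Lineage `b2b-balaban-t4-ne7-p2` (CRUX PROVER NE7 #2), generation 79; file 97.  b04's `B4Thm110ZeroBox` §8 with `Gfine ↦ GfineL`: with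
`A_j = 𝒢_j(s)Q_j^*`, `B_j = Q_j𝒢_j(s)`, `C_j = L^{−2(k−j)}C_s^{(j)}(□)` the recursion of file 96 reads `𝒢_{j+1}(s) − 𝒢_j(s) = α_j²·A_jC_jB_j`
(`GfineL_succ_sub`); the row∕column bounds `|A_j(x,y)|, L^{j(d+1)}|B_j(y,x)| ≤ L^{−2(k−j)}C₁e^{−κ|blk x − y|}` are (2.35) for the line
(file 95's `GfineL_blockRow_bound`, i.e. file 77's Lemma 2.4 first quantity for `(T^Π(s) + aQ^*Q)⁻¹Q^*` at every scale),
`|C_j(y,y′)| ≤ L^{−2(k−j)}c₂e^{−δ|y−y′|}` is (2.37) for the line (file 81's `cov237S_box_decay`); the weight `e^{δ₀|x−x′|∕L^k}` is absorbed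
by halving the three rates (b04's `exp_merge`), the three geometric sums cost `K(κ∕2)²K(δ∕2)·L^{j(d+1)}` (b04's `sum3_le`,
`fibre_sum_le`, `rho_sumBound`), the last factor cancelling the `L^{−j(d+1)}` of `Q_j`.  Net: **`step_term_bound_line`** —
`‖𝒢_{j+1}(s) − 𝒢_j(s)‖_{row,δ₀}(x) ≤ Θe^{δ₀}·L^{−2(k−j)}` with `(κ₀, Θ)` in `(d, ℓ, a₋, a₊)` ONLY: no `s`, `k`, `j`, box.

HONEST FRAMING: [folklore]; A = 0; b04's proof text re-run with the line's inputs; nothing of Bałaban's asserted; no `sorry`.  Census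
only (STEP 7, part 4); NE7 NOT PRINTED ∕ NOT PROVED; spine 0∕9; FIXED FINITE T⁴, rung (B)+1; NOT infinite volume, NOT mass gap, NOT
Clay.  HONEST DEPENDENCY: continuum YM on T⁴ ⇐ BetaPertH ∧ nine spine estimates (0/9 proved); BetaPertH ⇐ (D1) ∧ (D4) ∧ CAP+tail;
G-an2-4 gates asym, D1 and NE2/3/4.
-/

noncomputable section

open Finset Matrix

namespace Summit.QuantumFields.BalabanUV.T4Continuum.NE7K1LinBoxThm110Step

open Literature.MathematicalPhysics.QuantumFieldTheory.Balaban1983to89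
open Literature.MathematicalPhysics.QuantumFieldTheory.Balaban1983to89.B4Reflection242
open Literature.MathematicalPhysics.QuantumFieldTheory.Balaban1983to89.B4Lower18
open Literature.MathematicalPhysics.QuantumFieldTheory.Balaban1983to89.B4ContourShift (supNorm supNorm_nonneg)
open Literature.MathematicalPhysics.QuantumFieldTheory.Balaban1983to89.B4BoxCov237
open Literature.MathematicalPhysics.QuantumFieldTheory.Balaban1983to89.B4Thm110ZeroBox
open Literature.MathematicalPhysics.QuantumFieldTheory.Balaban1983to89.B4Sect5Proof (latticeConst latticeConst_nonneg latticeSum_le)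
open NE7K1LinSchurLineU1 NE7K1LinSchurFoldBox NE7K1LinBoxCovEnergy NE7K1LinLineLaplacian NE7K1LinBoxCov237 NE7K1LinBoxScales
open NE7K1LinBoxRGStep

variable {d : ℕ}

/-! ### The fluctuation term of one renormalization step in the weighted row norm -/

section StepBound

variable {ℓ k j : ℕ} {M : Fin (d + 1) → ℕ} {a s : ℝ}

/-- `A_j = 𝒢_j Q_j^*` (fine × unit). [folklore] -/
def AmatL (ℓ k : ℕ) (M : Fin (d + 1) → ℕ) (j : ℕ) (a s : ℝ) :
    Matrix ↥(boxDom (Nf ℓ k M)) ↥(boxDom (Mj ℓ k M j)) ℝ :=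
  GfineL ℓ k M j a s * QksM (bj ℓ j) (Mj ℓ k M j) (Nf ℓ k M)

/-- `B_j = Q_j 𝒢_j` (unit × fine). [folklore] -/
def BmatL (ℓ k : ℕ) (M : Fin (d + 1) → ℕ) (j : ℕ) (a s : ℝ) :
    Matrix ↥(boxDom (Mj ℓ k M j)) ↥(boxDom (Nf ℓ k M)) ℝ :=
  QkM (bj ℓ j) (Mj ℓ k M j) (Nf ℓ k M) * GfineL ℓ k M j a s

/-- `C_j = L^{-2(k-j)}·C_s^{(j)}(□)` in `L^{-k}`-units (unit × unit): the line's fluctuation covariance of file 80. [folklore] -/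
def CmatL (ℓ k : ℕ) (M : Fin (d + 1) → ℕ) (j : ℕ) (a s : ℝ) :
    Matrix ↥(boxDom (Mj ℓ k M j)) ↥(boxDom (Mj ℓ k M j)) ℝ :=
  (sc ℓ k j ^ 2)⁻¹ • (covOpS (ℓ + 1) (bj_pos ℓ j) ℓ (Mp ℓ k M j) (B1.aSeq a ((ℓ : ℝ) + 1) j) a s)⁻¹

/-- **THE FLUCTUATION TERM OF (2.34) FOR THE LINE**: `𝒢_{j+1}(s) − 𝒢_j(s) = α_j²·A_jC_jB_j` (file 96). [folklore] -/
theorem GfineL_succ_sub (hℓ : 1 ≤ ℓ) (hj1 : 1 ≤ j) (hj : j + 1 ≤ k) (hM : ∀ i, 1 ≤ M i) (ha : 0 < a)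
    (hs0 : 0 ≤ s) (hs1 : s ≤ 1) :
    GfineL ℓ k M (j + 1) a s - GfineL ℓ k M j a s
      = αj a ℓ k j ^ 2 • (AmatL ℓ k M j a s * CmatL ℓ k M j a s * BmatL ℓ k M j a s) := by
  rw [GfineL_succ hℓ hj1 hj hM ha hs0 hs1, add_sub_cancel_right]
  simp only [AmatL, BmatL, CmatL, Matrix.mul_assoc]

set_option maxHeartbeats 1600000 in
/-- **THE STEP BOUND FOR THE LINE**: there are `κ₀ > 0` and `Θ ≥ 0` (depending on `d, ℓ` and the window `[a₋, a₊]` only) such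
that for every weight rate `0 ≤ δ₀ ≤ κ₀`, every `1 ≤ j < k`, every `a` of the window, EVERY `s ∈ [0,1]` and every box,
`‖𝒢_{j+1}(s) − 𝒢_j(s)‖_{row,δ₀}(x) ≤ Θe^{δ₀}·L^{-2(k-j)}` — b04's `step_term_bound` re-run with (2.35) for the line (file 95's
`GfineL_blockRow_bound`) and (2.37) for the line (file 81's `cov237S_box_decay`). [cite: Balaban1983RegularityDecay, pp. 582–583
(2.34)–(2.38), for the two-cutoff line] -/
theorem step_term_bound_line (d ℓ : ℕ) (hℓ : 1 ≤ ℓ) (amin aplus : ℝ) (ha : 0 < amin) :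
    ∃ κ₀ Θ : ℝ, 0 < κ₀ ∧ 0 ≤ Θ ∧ ∀ (δ₀ : ℝ), 0 ≤ δ₀ → δ₀ ≤ κ₀ →
      ∀ (k j : ℕ), 1 ≤ j → ∀ (hj : j + 1 ≤ k), ∀ (a s : ℝ), amin ≤ a → a ≤ aplus → 0 ≤ s →
        s ≤ 1 → ∀ (M : Fin (d + 1) → ℕ), (∀ i, 1 ≤ M i) → ∀ (x : ↥(boxDom (Nf ℓ k M))),
          roww δ₀ ((ℓ + 1) ^ k) (GfineL ℓ k M (j + 1) a s - GfineL ℓ k M j a s) x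
            ≤ Θ * Real.exp δ₀ * (sc ℓ k j ^ 2)⁻¹ := by
  obtain ⟨κ, C₁, hκ, hC₁, hR⟩ := GfineL_blockRow_bound d ℓ hℓ amin aplus ha
  obtain ⟨δ, c₂, hδ, hc₂, hCov⟩ := cov237S_box_decay d ℓ hℓ (amin * (1 - ((((ℓ : ℝ) + 1)) ^ 2)⁻¹)) aplus
    amin aplus (aminus'_pos hℓ ha) ha (ℓ + 1)
  have hK0 : ∀ t : ℝ, 0 < t → 0 ≤ latticeConst (d + 1) t := fun t ht => latticeConst_nonneg _ ht.le
  have hKκ := hK0 _ (half_pos hκ)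
  have hKδ := hK0 _ (half_pos hδ)
  refine ⟨min κ δ / 2, aplus ^ 2 * (C₁ * c₂ * C₁)
      * (latticeConst (d + 1) (κ / 2) * latticeConst (d + 1) (δ / 2) * latticeConst (d + 1) (κ / 2)),
    by positivity, ?_, ?_⟩
  · exact mul_nonneg (mul_nonneg (sq_nonneg _) (mul_nonneg (mul_nonneg hC₁ hc₂.le) hC₁))
      (mul_nonneg (mul_nonneg hKκ hKδ) hKκ)
  intro δ₀ hδ0 hδ1 k j hj1 hj a s h1 h2 h3 h4 M hM x
  -- windows and positivity
  have ha0 : 0 < a := lt_of_lt_of_le ha h1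
  obtain ⟨hw1, hw2, hapos⟩ := aSeq_window hℓ ha h1 h2 hj1
  have hs : 0 < sc ℓ k j ^ 2 := pow_pos (sc_pos ℓ k j) 2
  have hsi : 0 < (sc ℓ k j ^ 2)⁻¹ := inv_pos.2 hs
  have hsc0 : sc ℓ k j ≠ 0 := (sc_pos ℓ k j).ne'
  have hb1 : 1 ≤ bj ℓ j := bj_pos ℓ j
  have hbD : (0 : ℝ) < ((bj ℓ j : ℕ) : ℝ) ^ (d + 1) := by positivity
  have hbD0 : ((bj ℓ j : ℕ) : ℝ) ≠ 0 := by positivity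
  have hδκ : δ₀ ≤ κ / 2 := hδ1.trans (by linarith [min_le_left κ δ])
  have hδδ : δ₀ ≤ δ / 2 := hδ1.trans (by linarith [min_le_right κ δ])
  -- entry bounds of the three kernels
  have hA : ∀ (x : ↥(boxDom (Nf ℓ k M))) (y : ↥(boxDom (Mj ℓ k M j))),
      |AmatL ℓ k M j a s x y|
        ≤ (sc ℓ k j ^ 2)⁻¹ * C₁ * Real.exp (-(κ * supNorm (blk (bj ℓ j) x.1 - y.1))) := by
    intro x y
    have hAxy : AmatL ℓ k M j a s x y
        = ∑ x', (if blk (bj ℓ j) x'.1 = y.1 then GfineL ℓ k M j a s x x' else 0) := by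
      simp only [AmatL, Matrix.mul_apply, QksM, Matrix.of_apply, mul_ite, mul_one, mul_zero]
    rw [hAxy]
    exact hR k j hj1 hj a s h1 h2 h3 h4 M hM x y.1 y.2
  have hB : ∀ (y' : ↥(boxDom (Mj ℓ k M j))) (x' : ↥(boxDom (Nf ℓ k M))),
      |BmatL ℓ k M j a s y' x'| ≤ ((((bj ℓ j : ℕ) : ℝ)) ^ (d + 1))⁻¹ *
        ((sc ℓ k j ^ 2)⁻¹ * C₁ * Real.exp (-(κ * supNorm (blk (bj ℓ j) x'.1 - y'.1)))) := by
    intro y' x'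
    have hBe : BmatL ℓ k M j a s y' x' = ((((bj ℓ j : ℕ) : ℝ)) ^ (d + 1))⁻¹ *
        ∑ w, (if blk (bj ℓ j) w.1 = y'.1 then GfineL ℓ k M j a s x' w else 0) := by
      simp only [BmatL, Matrix.mul_apply, QkM, Matrix.of_apply, Finset.mul_sum]
      refine Finset.sum_congr rfl fun w _ => ?_
      split_ifs with hw
      · rw [(GfineL_isSymm ℓ k M j a s).apply x' w]
      · rw [zero_mul, mul_zero]
    rw [hBe, abs_mul, abs_of_pos (inv_pos.2 hbD)]
    exact mul_le_mul_of_nonneg_left (hR k j hj1 hj a s h1 h2 h3 h4 M hM x' y'.1 y'.2) (inv_pos.2 hbD).le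
  have hC : ∀ (y y' : ↥(boxDom (Mj ℓ k M j))),
      |CmatL ℓ k M j a s y y'| ≤ (sc ℓ k j ^ 2)⁻¹ * (c₂ * Real.exp (-(δ * supNorm (y.1 - y'.1)))) := by
    intro y y'
    have h := (hCov (bj ℓ j) hb1 _ a s hw1 hw2 h1 h2 h3 h4 (Mp ℓ k M j) (Mp_pos hM)).2 y y'
    rw [CmatL, Matrix.smul_apply, smul_eq_mul, abs_mul, abs_of_pos hsi]
    exact mul_le_mul_of_nonneg_left h hsi.le
  -- the weight: `|x − x′|/L^k ≤ |blk x − y| + |y − y′| + |blk x′ − y′| + 1`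
  have hnR : ((((ℓ + 1) ^ k : ℕ)) : ℝ) = sc ℓ k j * ((bj ℓ j : ℕ) : ℝ) := by
    rw [sc_mul_bj (by omega : j ≤ k)]
    push_cast
    ring
  have hn0 : (0 : ℝ) < (((ℓ + 1) ^ k : ℕ) : ℝ) := by positivity
  have hwt : ∀ (x x' : ↥(boxDom (Nf ℓ k M))) (y y' : ↥(boxDom (Mj ℓ k M j))),
      δ₀ * supNorm (x.1 - x'.1) / (((ℓ + 1) ^ k : ℕ) : ℝ)
        ≤ δ₀ * (supNorm (blk (bj ℓ j) x.1 - y.1) + supNorm (y.1 - y'.1)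
            + supNorm (blk (bj ℓ j) x'.1 - y'.1) + 1) := by
    intro x x' y y'
    rw [mul_div_assoc]
    refine mul_le_mul_of_nonneg_left ?_ hδ0
    rw [div_le_iff₀ hn0, hnR]
    have t1 := supNorm_sub_le_sub_add_sub (blk (bj ℓ j) x.1) y.1 (blk (bj ℓ j) x'.1)
    have t2 := supNorm_sub_le_sub_add_sub y.1 y'.1 (blk (bj ℓ j) x'.1)
    rw [show supNorm (y'.1 - blk (bj ℓ j) x'.1) = supNorm (blk (bj ℓ j) x'.1 - y'.1) from by
        rw [← B4TorusKernel.supNorm_neg, neg_sub]] at t2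
    have hblk := supNorm_sub_le_blk hb1 x.1 x'.1
    have hp0 := supNorm_nonneg (blk (bj ℓ j) x.1 - y.1)
    have hq0 := supNorm_nonneg (y.1 - y'.1)
    have hr0 := supNorm_nonneg (blk (bj ℓ j) x'.1 - y'.1)
    have hbR : (0 : ℝ) ≤ ((bj ℓ j : ℕ) : ℝ) := Nat.cast_nonneg _
    have hsc1 := one_le_sc ℓ k j
    have h5 : supNorm (x.1 - x'.1) ≤ ((bj ℓ j : ℕ) : ℝ) * (supNorm (blk (bj ℓ j) x.1 - y.1)
        + supNorm (y.1 - y'.1) + supNorm (blk (bj ℓ j) x'.1 - y'.1) + 1) :=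
      hblk.trans (mul_le_mul_of_nonneg_left (by linarith) hbR)
    have h6 : 0 ≤ ((bj ℓ j : ℕ) : ℝ) * (supNorm (blk (bj ℓ j) x.1 - y.1)
        + supNorm (y.1 - y'.1) + supNorm (blk (bj ℓ j) x'.1 - y'.1) + 1) :=
      mul_nonneg hbR (by linarith)
    calc supNorm (x.1 - x'.1) ≤ ((bj ℓ j : ℕ) : ℝ) * (supNorm (blk (bj ℓ j) x.1 - y.1)
          + supNorm (y.1 - y'.1) + supNorm (blk (bj ℓ j) x'.1 - y'.1) + 1) := h5
      _ = 1 * (((bj ℓ j : ℕ) : ℝ) * (supNorm (blk (bj ℓ j) x.1 - y.1)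
          + supNorm (y.1 - y'.1) + supNorm (blk (bj ℓ j) x'.1 - y'.1) + 1)) := (one_mul _).symm
      _ ≤ sc ℓ k j * (((bj ℓ j : ℕ) : ℝ) * (supNorm (blk (bj ℓ j) x.1 - y.1)
          + supNorm (y.1 - y'.1) + supNorm (blk (bj ℓ j) x'.1 - y'.1) + 1)) :=
        mul_le_mul_of_nonneg_right hsc1 h6
      _ = _ := by ring
  -- the per-term estimate
  have hterm : ∀ (x x' : ↥(boxDom (Nf ℓ k M))) (y y' : ↥(boxDom (Mj ℓ k M j))),
      |AmatL ℓ k M j a s x y| * |CmatL ℓ k M j a s y y'| * |BmatL ℓ k M j a s y' x'|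
          * Real.exp (δ₀ * supNorm (x.1 - x'.1) / (((ℓ + 1) ^ k : ℕ) : ℝ))
        ≤ ((sc ℓ k j ^ 2)⁻¹ * C₁ * ((sc ℓ k j ^ 2)⁻¹ * c₂)
            * (((((bj ℓ j : ℕ) : ℝ)) ^ (d + 1))⁻¹ * ((sc ℓ k j ^ 2)⁻¹ * C₁))) * Real.exp δ₀
          * (Real.exp (-(κ / 2 * supNorm (blk (bj ℓ j) x.1 - y.1)))
              * Real.exp (-(δ / 2 * supNorm (y.1 - y'.1)))
              * Real.exp (-(κ / 2 * supNorm (blk (bj ℓ j) x'.1 - y'.1)))) := by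
    intro x x' y y'
    have e1 := hA x y
    have e2 := hC y y'
    have e3 := hB y' x'
    have n1 : 0 ≤ (sc ℓ k j ^ 2)⁻¹ * C₁ * Real.exp (-(κ * supNorm (blk (bj ℓ j) x.1 - y.1))) :=
      mul_nonneg (mul_nonneg hsi.le hC₁) (Real.exp_pos _).le
    have n2 : 0 ≤ (sc ℓ k j ^ 2)⁻¹ * (c₂ * Real.exp (-(δ * supNorm (y.1 - y'.1)))) :=
      mul_nonneg hsi.le (mul_nonneg hc₂.le (Real.exp_pos _).le)
    have n3 : 0 ≤ ((((bj ℓ j : ℕ) : ℝ)) ^ (d + 1))⁻¹ *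
        ((sc ℓ k j ^ 2)⁻¹ * C₁ * Real.exp (-(κ * supNorm (blk (bj ℓ j) x'.1 - y'.1)))) :=
      mul_nonneg (inv_pos.2 hbD).le (mul_nonneg (mul_nonneg hsi.le hC₁) (Real.exp_pos _).le)
    have hprod := mul_le_mul (mul_le_mul e1 e2 (abs_nonneg _) n1) e3 (abs_nonneg _) (mul_nonneg n1 n2)
    have hm := exp_merge (supNorm_nonneg (blk (bj ℓ j) x.1 - y.1)) (supNorm_nonneg (y.1 - y'.1))
      (supNorm_nonneg (blk (bj ℓ j) x'.1 - y'.1)) hδκ hδδ (hwt x x' y y')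
    have hP0 : 0 ≤ (sc ℓ k j ^ 2)⁻¹ * C₁ * ((sc ℓ k j ^ 2)⁻¹ * c₂)
        * (((((bj ℓ j : ℕ) : ℝ)) ^ (d + 1))⁻¹ * ((sc ℓ k j ^ 2)⁻¹ * C₁)) :=
      mul_nonneg (mul_nonneg (mul_nonneg hsi.le hC₁) (mul_nonneg hsi.le hc₂.le))
        (mul_nonneg (inv_pos.2 hbD).le (mul_nonneg hsi.le hC₁))
    calc |AmatL ℓ k M j a s x y| * |CmatL ℓ k M j a s y y'| * |BmatL ℓ k M j a s y' x'|
            * Real.exp (δ₀ * supNorm (x.1 - x'.1) / (((ℓ + 1) ^ k : ℕ) : ℝ))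
        ≤ ((sc ℓ k j ^ 2)⁻¹ * C₁ * Real.exp (-(κ * supNorm (blk (bj ℓ j) x.1 - y.1)))
            * ((sc ℓ k j ^ 2)⁻¹ * (c₂ * Real.exp (-(δ * supNorm (y.1 - y'.1)))))
            * (((((bj ℓ j : ℕ) : ℝ)) ^ (d + 1))⁻¹ *
                ((sc ℓ k j ^ 2)⁻¹ * C₁ * Real.exp (-(κ * supNorm (blk (bj ℓ j) x'.1 - y'.1))))))
            * Real.exp (δ₀ * supNorm (x.1 - x'.1) / (((ℓ + 1) ^ k : ℕ) : ℝ)) :=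
          mul_le_mul_of_nonneg_right hprod (Real.exp_pos _).le
      _ = ((sc ℓ k j ^ 2)⁻¹ * C₁ * ((sc ℓ k j ^ 2)⁻¹ * c₂)
            * (((((bj ℓ j : ℕ) : ℝ)) ^ (d + 1))⁻¹ * ((sc ℓ k j ^ 2)⁻¹ * C₁)))
            * (Real.exp (δ₀ * supNorm (x.1 - x'.1) / (((ℓ + 1) ^ k : ℕ) : ℝ))
              * (Real.exp (-(κ * supNorm (blk (bj ℓ j) x.1 - y.1)))
                  * Real.exp (-(δ * supNorm (y.1 - y'.1)))
                  * Real.exp (-(κ * supNorm (blk (bj ℓ j) x'.1 - y'.1))))) := by ring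
      _ ≤ ((sc ℓ k j ^ 2)⁻¹ * C₁ * ((sc ℓ k j ^ 2)⁻¹ * c₂)
            * (((((bj ℓ j : ℕ) : ℝ)) ^ (d + 1))⁻¹ * ((sc ℓ k j ^ 2)⁻¹ * C₁)))
            * (Real.exp δ₀ * (Real.exp (-(κ / 2 * supNorm (blk (bj ℓ j) x.1 - y.1)))
              * Real.exp (-(δ / 2 * supNorm (y.1 - y'.1)))
              * Real.exp (-(κ / 2 * supNorm (blk (bj ℓ j) x'.1 - y'.1))))) :=
          mul_le_mul_of_nonneg_left hm hP0
      _ = _ := by ring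
  -- the weighted row sum of `A C B`
  have hF := rho_sumBound (Mj ℓ k M j) (κ / 2) (half_pos hκ) ⟨blk (bj ℓ j) x.1, blk_bj_mem hj M x⟩
  have hsum : roww δ₀ ((ℓ + 1) ^ k) (AmatL ℓ k M j a s * CmatL ℓ k M j a s * BmatL ℓ k M j a s) x
      ≤ ((sc ℓ k j ^ 2)⁻¹ * C₁ * ((sc ℓ k j ^ 2)⁻¹ * c₂)
            * (((((bj ℓ j : ℕ) : ℝ)) ^ (d + 1))⁻¹ * ((sc ℓ k j ^ 2)⁻¹ * C₁))) * Real.exp δ₀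
          * (latticeConst (d + 1) (κ / 2) * latticeConst (d + 1) (δ / 2)
              * (((bj ℓ j : ℕ) : ℝ) ^ (d + 1) * latticeConst (d + 1) (κ / 2))) := by
    unfold roww
    calc ∑ x', |(AmatL ℓ k M j a s * CmatL ℓ k M j a s * BmatL ℓ k M j a s) x x'|
            * Real.exp (δ₀ * supNorm (x.1 - x'.1) / (((ℓ + 1) ^ k : ℕ) : ℝ))
        ≤ ∑ x', (∑ y', ∑ y, |AmatL ℓ k M j a s x y| * |CmatL ℓ k M j a s y y'|
              * |BmatL ℓ k M j a s y' x'|)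
            * Real.exp (δ₀ * supNorm (x.1 - x'.1) / (((ℓ + 1) ^ k : ℕ) : ℝ)) := by
          refine Finset.sum_le_sum fun x' _ => mul_le_mul_of_nonneg_right ?_ (Real.exp_pos _).le
          rw [Matrix.mul_apply]
          refine (Finset.abs_sum_le_sum_abs _ _).trans (Finset.sum_le_sum fun y' _ => ?_)
          rw [Matrix.mul_apply, abs_mul]
          refine (mul_le_mul_of_nonneg_right (Finset.abs_sum_le_sum_abs _ _) (abs_nonneg _)).trans ?_
          rw [Finset.sum_mul]
          refine Finset.sum_le_sum fun y _ => ?_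
          rw [abs_mul]
      _ = ∑ x', ∑ y', ∑ y, |AmatL ℓ k M j a s x y| * |CmatL ℓ k M j a s y y'|
              * |BmatL ℓ k M j a s y' x'|
            * Real.exp (δ₀ * supNorm (x.1 - x'.1) / (((ℓ + 1) ^ k : ℕ) : ℝ)) := by
          refine Finset.sum_congr rfl fun x' _ => ?_
          rw [Finset.sum_mul]
          refine Finset.sum_congr rfl fun y' _ => ?_
          rw [Finset.sum_mul]
      _ ≤ ∑ x' : ↥(boxDom (Nf ℓ k M)), ∑ y' : ↥(boxDom (Mj ℓ k M j)), ∑ y : ↥(boxDom (Mj ℓ k M j)),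
          ((sc ℓ k j ^ 2)⁻¹ * C₁ * ((sc ℓ k j ^ 2)⁻¹ * c₂)
            * (((((bj ℓ j : ℕ) : ℝ)) ^ (d + 1))⁻¹ * ((sc ℓ k j ^ 2)⁻¹ * C₁))) * Real.exp δ₀
          * (Real.exp (-(κ / 2 * supNorm (blk (bj ℓ j) x.1 - y.1)))
              * Real.exp (-(δ / 2 * supNorm (y.1 - y'.1)))
              * Real.exp (-(κ / 2 * supNorm (blk (bj ℓ j) x'.1 - y'.1)))) :=
          by
            apply Finset.sum_le_sum
            intro x' _
            apply Finset.sum_le_sum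
            intro y' _
            apply Finset.sum_le_sum
            intro y _
            exact hterm x x' y y'
      _ = ((sc ℓ k j ^ 2)⁻¹ * C₁ * ((sc ℓ k j ^ 2)⁻¹ * c₂)
            * (((((bj ℓ j : ℕ) : ℝ)) ^ (d + 1))⁻¹ * ((sc ℓ k j ^ 2)⁻¹ * C₁))) * Real.exp δ₀
          * ∑ x' : ↥(boxDom (Nf ℓ k M)), ∑ y' : ↥(boxDom (Mj ℓ k M j)), ∑ y : ↥(boxDom (Mj ℓ k M j)),
              Real.exp (-(κ / 2 * supNorm (blk (bj ℓ j) x.1 - y.1)))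
              * Real.exp (-(δ / 2 * supNorm (y.1 - y'.1)))
              * Real.exp (-(κ / 2 * supNorm (blk (bj ℓ j) x'.1 - y'.1))) := by
          rw [Finset.mul_sum]
          refine Finset.sum_congr rfl fun x' _ => ?_
          rw [Finset.mul_sum]
          refine Finset.sum_congr rfl fun y' _ => ?_
          rw [Finset.mul_sum]
      _ ≤ _ := by
          refine mul_le_mul_of_nonneg_left ?_ (mul_nonneg ?_ (Real.exp_pos _).le)
          · exact sum3_le (fun y : ↥(boxDom (Mj ℓ k M j)) =>
                Real.exp (-(κ / 2 * supNorm (blk (bj ℓ j) x.1 - y.1))))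
              (fun y y' : ↥(boxDom (Mj ℓ k M j)) => Real.exp (-(δ / 2 * supNorm (y.1 - y'.1))))
              (fun (y' : ↥(boxDom (Mj ℓ k M j))) (x' : ↥(boxDom (Nf ℓ k M))) =>
                Real.exp (-(κ / 2 * supNorm (blk (bj ℓ j) x'.1 - y'.1))))
              (fun _ => (Real.exp_pos _).le) (fun _ _ => (Real.exp_pos _).le) hKδ (mul_nonneg hbD.le hKκ) hF
              (fun y => rho_sumBound (Mj ℓ k M j) (δ / 2) (half_pos hδ) y)
              (fun y' => fibre_sum_le hj M (half_pos hκ) y')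
          · exact mul_nonneg (mul_nonneg (mul_nonneg hsi.le hC₁) (mul_nonneg hsi.le hc₂.le))
              (mul_nonneg (inv_pos.2 hbD).le (mul_nonneg hsi.le hC₁))
  -- assembling: `α_j² ≤ a₊²·L^{4(k-j)}`
  have hα : αj a ℓ k j ^ 2 ≤ aplus ^ 2 * (sc ℓ k j ^ 2) ^ 2 := by
    unfold αj
    rw [mul_pow]
    exact mul_le_mul_of_nonneg_right (pow_le_pow_left₀ hapos.le hw2 2) (by positivity)
  rw [GfineL_succ_sub hℓ hj1 hj hM ha0 h3 h4, roww_smul _ _ (sq_nonneg _)]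
  calc αj a ℓ k j ^ 2 * roww δ₀ ((ℓ + 1) ^ k) (AmatL ℓ k M j a s * CmatL ℓ k M j a s * BmatL ℓ k M j a s) x
      ≤ (aplus ^ 2 * (sc ℓ k j ^ 2) ^ 2) *
          (((sc ℓ k j ^ 2)⁻¹ * C₁ * ((sc ℓ k j ^ 2)⁻¹ * c₂)
            * (((((bj ℓ j : ℕ) : ℝ)) ^ (d + 1))⁻¹ * ((sc ℓ k j ^ 2)⁻¹ * C₁))) * Real.exp δ₀
          * (latticeConst (d + 1) (κ / 2) * latticeConst (d + 1) (δ / 2)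
              * (((bj ℓ j : ℕ) : ℝ) ^ (d + 1) * latticeConst (d + 1) (κ / 2)))) :=
        mul_le_mul hα hsum (roww_nonneg _ _ _ _) (by positivity)
    _ = aplus ^ 2 * (C₁ * c₂ * C₁)
          * (latticeConst (d + 1) (κ / 2) * latticeConst (d + 1) (δ / 2) * latticeConst (d + 1) (κ / 2))
          * Real.exp δ₀ * (sc ℓ k j ^ 2)⁻¹ := by
        field_simp

end StepBound

end Summit.QuantumFields.BalabanUV.T4Continuum.NE7K1LinBoxThm110Step

end
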